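import Summits.HodgeConjecture.HodgeConjecture.Theorems.PadicSemiregularLiftHodgeLocusPropagation
import Summits.HodgeConjecture.HodgeConjecture.Theorems.Ring2HypothesesFlatSectionsVHCCurveBase
import Literature.AlgebraicGeometry.HodgeTheory.AlgebraicityLocusCurveBaseDichotomy
import Literature.AlgebraicGeometry.HodgeTheory.GenericComplexPointsOverCountableFields
import Literature.AlgebraicGeometry.HodgeTheory.QuasiProjectiveOfAffine
import Literature.AlgebraicGeometry.HodgeTheory.HodgeGenericQbarDescentProofs

/-!
# Route AnchorTransport — crux `VariationalHodge` (stmt-HodgeConjecture-1076), line `padic-disc-transport`: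
# towards STUB G (`GenericPropagation`) — the generic point, the curve-base dichotomy, the trivial ranges

HONEST FRAMING: research route conditional on HC_CM; not a corollary; Q11.4-sentence-2 already refuted in dim ≥ 3.
Helper file on the crux item (nothing here closes it; no definition, no named fact, no `sorry`;
`HC_CM` does not occur). Cell `pub-hodge-ring2`, binder seat `ring2-b03` (gen 31), BINDER-OWNERS row b03.

STUB G of the registered skeleton `Cruxes/VariationalHodge/Lines/padic_disc_transport.lean`
(`PadicDiscTransport.GenericPropagation`): for a smooth projective family `f₀ ⊗_σ ℂ : 𝒳 ⟶ S`
base-changed from a COUNTABLE field `k` along `σ : k →+* ℂ`, over a smooth irreducible affine curve,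
a global class `A ∈ H²ᵖ(𝒳(ℂ); ℂ)` algebraic on the fibre over ONE `k`-generic complex point `s`
(`IsGenericPoint k σ s`: `s` lies in no proper subset of `S(ℂ)` defined over `σ(k)` in Weil's sense)
is algebraic on every fibre. This file lands three sorry-free pieces of it, with the stub's binders
copied verbatim (the skeleton's local `def`s are not importable under `Theorems/`):

* `base_pt_eq_genericPoint_of_isGenericPoint` — **the `k`-generic point lies over the generic point
  of `S₀`** (Charles–Schnell, Lemma 11.3.14), from the tree theorem
  `base_pt_eq_genericPoint_of_weilGeneric` (`GenericComplexPointsOverCountableFields`, this seat):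
  the base `S₀` is irreducible (its complexification is) and locally of finite type over `k` (fpqc
  descent of `LocallyOfFiniteType` along `Spec ℂ → Spec k`, Mathlib). With the converse for the
  record (`isGenericPoint_iff_base_pt_eq_genericPoint`, `k` countable).
* `mem_algebraicClasses_of_not_countable_of_curveBase` — **over the stub's curve bases, for a
  QUASI-PROJECTIVE total space, uncountably many algebraic fibres force every fibre** (the tree
  theorem `mem_algebraicClasses_of_not_countable_of_smoothCurve` of
  `AlgebraicityLocusCurveBaseDichotomy`, this seat — a corollary of the PROVED structure theorem
  `charlesSchnell_algebraicityLocus_iUnion_closed_holds` — with the stub's base hypotheses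
  `IrreducibleSpace` / `IsAffine` / `Smooth` / `topologicalKrullDim = 1` converted to "smooth
  integral quasi-projective curve").
* `genericPropagation_isQuasiProjective_of_uncountablePropagation` — **STUB G for quasi-projective
  total spaces FOLLOWS from "uncountable propagation"**: if algebraicity at a complex point over
  the generic point of `S₀` yields algebraicity over an UNCOUNTABLE set of complex points (the
  output of the spreading argument: the support of `A|_{𝒳_s}` spreads over a variety `T₀ → S₀`
  dominating `S₀`, and flat transport of the spread classes makes `A` algebraic over the image of
  `T(ℂ)`), then `A` is algebraic on every fibre. Binder-for-binder the stub plus ONE hypothesis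
  (`IsQuasiProjectiveOver (𝒳₀ ⊗_σ ℂ)`).
* `genericPropagation_of_eq_zero_or_lt` — the stub in the trivial degree ranges `p = 0` and
  `p > n`, for ALL data, unconditionally (`HodgeLocusPropagation_zero/_of_lt`).

What is NOT here: the spreading half ("uncountable propagation") — field-of-definition spread of the
support of `A|_{𝒳_s}` over a dominant `T₀ → S₀` (limit descent, as in the tree's
`AlgebraicCyclesDefinedOverQbarParameter.exists_generic_parameter`, family version), a spread class
`κ` non-zero on the generic fibre (Gysin image of a resolution in a smooth compactification of
`𝒳 ×_S T`, clean base change at the `k`-generic parameter — where every bad locus is `k`-closed and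
so misses `t`), purity on `𝒳_s` and rigidity of fibre restrictions of global classes over the
connected `T(ℂ)` (`AlgebraicityLocusProofs.mem_span_map_fiberι_of_mem_span_of_irreducibleSpace`);
and the non-quasi-projective case of the stub (proper non-projective total spaces), for which the
tree has no Thom class of a subvariety of a non-compact ambient manifold.

References: [CharlesSchnell2014Notes] Prop. 11.3.11 (proof), Lemma 11.3.14; [Voisin2007HodgeLoci]
§0 and §3; [VoisinHodgeII2003] §3.3.1, §7.3.2; [Lang1958IAG] III §5.
-/

noncomputable section

-- every declaration of this problem lives in `Summit.HodgeConjecture.HodgeConjecture.…` (summit = sub-problem)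
set_option linter.dupNamespace false

open CategoryTheory AlgebraicGeometry TopologicalSpace
open Literature.AlgebraicGeometry.Motives Literature.AlgebraicGeometry.HodgeTheory

namespace Summit.HodgeConjecture.HodgeConjecture.Theorems

/-! ### The base of the descended crux: a smooth integral quasi-projective curve, its `k`-form irreducible of finite type -/

section Base

variable {k : Type} [Field k] (σ : k →+* ℂ) (S₀ : SchemeOver k)

/-- `Spec ℂ → Spec k` (along `σ`) is surjective, flat and quasi-compact — the fpqc cover along which
properties of `S₀` are read off from `S₀ ⊗_σ ℂ`. [folklore] -/
theorem surjective_flat_quasiCompact_specMap :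
    (@Surjective ⊓ @Flat ⊓ @QuasiCompact : MorphismProperty Scheme)
      (Spec.map (CommRingCat.ofHom σ)) := by
  letI := σ.toAlgebra
  haveI : Subsingleton ↥(Spec (CommRingCat.of k)) :=
    inferInstanceAs (Subsingleton (PrimeSpectrum k))
  haveI : Surjective (Spec.map (CommRingCat.ofHom σ)) :=
    ⟨fun x ↦ ⟨(default : ↥(Spec (CommRingCat.of ℂ))), Subsingleton.elim _ _⟩⟩
  haveI : Flat (Spec.map (CommRingCat.ofHom σ)) := by
    rw [HasRingHomProperty.Spec_iff (P := @Flat)]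
    change Module.Flat k ℂ
    infer_instance
  exact ⟨⟨inferInstance, inferInstance⟩, inferInstance⟩

/-- **The `k`-form of the base is locally of finite type** when its complexification is smooth over
`ℂ` (fpqc descent of `LocallyOfFiniteType` along `Spec ℂ → Spec k`, Mathlib `LocalFlatDescent`).
[folklore] -/
theorem locallyOfFiniteType_of_smooth_baseChangeHom
    [AlgebraicGeometry.Smooth ((baseChangeHom σ).obj S₀).hom] : LocallyOfFiniteType S₀.hom := by
  have h1 : LocallyOfFiniteType ((baseChangeHom σ).obj S₀).hom := inferInstance
  exact MorphismProperty.of_pullback_snd_of_descendsAlong (P := @LocallyOfFiniteType)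
    (Q := @Surjective ⊓ @Flat ⊓ @QuasiCompact) (f := S₀.hom) (g := Spec.map (CommRingCat.ofHom σ))
    (surjective_flat_quasiCompact_specMap σ) h1

/-- **The `k`-form of the base is irreducible** when its complexification is: `S₀ ⊗_σ ℂ → S₀` is
surjective (base change of `Spec ℂ → Spec k`) and continuous. [folklore] -/
theorem irreducibleSpace_of_baseChangeHom [IrreducibleSpace ((baseChangeHom σ).obj S₀).left] :
    IrreducibleSpace S₀.left := by
  haveI : Surjective (baseChangeHomFst σ S₀) :=
    MorphismProperty.pullback_fst _ _ (surjective_flat_quasiCompact_specMap σ).1.1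
  have hsurj : Function.Surjective (baseChangeHomFst σ S₀).base := (baseChangeHomFst σ S₀).surjective
  have h : IsIrreducible (Set.univ : Set S₀.left) := by
    rw [← Set.image_univ_of_surjective hsurj]
    exact (IrreducibleSpace.isIrreducible_univ _).image _
      (baseChangeHomFst σ S₀).base.hom.continuous.continuousOn
  exact (irreducibleSpace_def _).2 h

/-- **`k`-generic ⟹ over the generic point** (Charles–Schnell, Lemma 11.3.14, for the base of the
descended crux): if `S₀ ⊗_σ ℂ` is smooth over `ℂ` with irreducible underlying space and
`s ∈ S(ℂ)` is `k`-generic in Weil's sense (`PadicDiscTransport.IsGenericPoint k σ s`, unfolded),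
then `s` lies over the generic point of `S₀`. [cite: CharlesSchnell2014Notes, Lemma 11.3.14 (proof)] -/
theorem base_pt_eq_genericPoint_of_isGenericPoint
    [AlgebraicGeometry.Smooth ((baseChangeHom σ).obj S₀).hom]
    [IrreducibleSpace ((baseChangeHom σ).obj S₀).left]
    {s : ComplexPoints ((baseChangeHom σ).obj S₀)}
    (hs : ∀ Z : Set (ComplexPoints ((baseChangeHom σ).obj S₀)),
      IsDefinedOver σ S₀ σ.fieldRange Z → s ∈ Z → Z = Set.univ) :
    haveI := irreducibleSpace_of_baseChangeHom σ S₀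
    (baseChangeHomFst σ S₀).base s.pt = genericPoint S₀.left := by
  haveI := locallyOfFiniteType_of_smooth_baseChangeHom σ S₀
  haveI := irreducibleSpace_of_baseChangeHom σ S₀
  exact base_pt_eq_genericPoint_of_weilGeneric σ S₀ σ.fieldRange hs

/-- **`k`-generic ⟺ over the generic point**, for `k` countable (the converse direction is Lang's
C4 ⇒ C7 through a generic point, `weilGeneric_of_closure_base_pt_eq_univ`).
[cite: CharlesSchnell2014Notes, Lemma 11.3.14 (proof)] [cite: Lang1958IAG, Ch. III §5, C4–C7] -/
theorem isGenericPoint_iff_base_pt_eq_genericPoint [Countable k]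
    [AlgebraicGeometry.Smooth ((baseChangeHom σ).obj S₀).hom]
    [IrreducibleSpace ((baseChangeHom σ).obj S₀).left]
    (s : ComplexPoints ((baseChangeHom σ).obj S₀)) :
    haveI := irreducibleSpace_of_baseChangeHom σ S₀
    (∀ Z : Set (ComplexPoints ((baseChangeHom σ).obj S₀)),
        IsDefinedOver σ S₀ σ.fieldRange Z → s ∈ Z → Z = Set.univ) ↔
      (baseChangeHomFst σ S₀).base s.pt = genericPoint S₀.left := by
  haveI := locallyOfFiniteType_of_smooth_baseChangeHom σ S₀
  haveI := irreducibleSpace_of_baseChangeHom σ S₀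
  exact weilGeneric_fieldRange_iff_base_pt_eq_genericPoint s

end Base

/-! ### Over the stub's curve bases: uncountably many algebraic fibres force every fibre (quasi-projective total space) -/

section CurveBase

/-- **The stub's base hypotheses make `S` a smooth integral curve.** [folklore] -/
theorem isIntegral_of_irreducibleSpace_of_smooth (S : SchemeOver ℂ) [IrreducibleSpace S.left]
    [AlgebraicGeometry.Smooth S.hom] : IsIntegral S.left := by
  haveI : IsReduced S.left := isReduced_of_smooth_over_field S.hom
  exact isIntegral_of_irreducibleSpace_of_isReduced S.left

/-- **Uncountably many algebraic fibres force every fibre** (quasi-projective total space, curve base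
of the stub's shape): for a smooth projective family `f : 𝒳 ⟶ S` of relative dimension `n` with
`𝒳` quasi-projective over `ℂ`, over a smooth irreducible affine `S` of topological Krull dimension
`1`, and a global class `A ∈ H²ᵖ(𝒳(ℂ); ℂ)` whose fibre restrictions are algebraic over a set of
complex points which is NOT countable, `A|_{𝒳_t}` is algebraic at EVERY complex point `t`
(`mem_algebraicClasses_of_not_countable_of_smoothCurve`: the algebraicity locus is `⋃_j W_j(ℂ)`
with `W_j ⊆ S` closed, and a proper closed subset of a curve is finite).
[cite: CharlesSchnell2014Notes, Prop. 11.3.11 (proof)] [cite: VoisinHodgeII2003, §7.3.2 (proof of Thm. 7.19)] -/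
theorem mem_algebraicClasses_of_not_countable_of_curveBase {n : ℕ} {𝒳 S : SchemeOver ℂ}
    (f : 𝒳 ⟶ S) (hf : IsSmoothProjectiveFamily f n) (hirr : IrreducibleSpace S.left)
    (haff : IsAffine S.left) (hsm : AlgebraicGeometry.Smooth S.hom)
    (hdim : topologicalKrullDim S.left = 1) (h𝒳 : IsQuasiProjectiveOver 𝒳) (p : ℕ)
    (A : complexBetti 𝒳 (2 * p)) {G : Set (ComplexPoints S)} (hG : ¬ G.Countable)
    (hGalg : ∀ t ∈ G, complexBetti.map (fiberι f t) (2 * p) A ∈ algebraicClasses (fiberOver f t) p)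
    (t : ComplexPoints S) :
    complexBetti.map (fiberι f t) (2 * p) A ∈ algebraicClasses (fiberOver f t) p := by
  haveI := hirr
  haveI := haff
  haveI := hsm
  haveI : LocallyOfFiniteType S.hom := inferInstance
  haveI : IsIntegral S.left := isIntegral_of_irreducibleSpace_of_smooth S
  haveI : SmoothOfRelativeDimension 1 S.hom :=
    Ring2.Hypotheses.smoothOfRelativeDimension_one_of_topologicalKrullDim S hdim
  exact mem_algebraicClasses_of_not_countable_of_smoothCurve f h𝒳
    (IsQuasiProjectiveOver.of_isAffine S) hf p A hG hGalg t

end CurveBase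

/-! ### STUB G for quasi-projective total spaces, from uncountable propagation -/

section Reduction

/-- **STUB G (`GenericPropagation`) for QUASI-PROJECTIVE total spaces follows from UNCOUNTABLE
PROPAGATION.** Hypothesis `hU`: for every descended family over a curve base of the stub's shape with
quasi-projective complexified total space, every global class `A` and every complex point `s` over
the generic point of `S₀` (phrased without instances: the point of `S₀` under `s` is dense), if
`A|_{𝒳_s}` is algebraic then the set of complex points with algebraic fibre restriction is not
countable. Conclusion: the stub `GenericPropagation` with its binders copied verbatim plus the one
hypothesis `IsQuasiProjectiveOver (𝒳₀ ⊗_σ ℂ)`. Proof: a `k`-generic point lies over the generic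
point (`base_pt_eq_genericPoint_of_isGenericPoint`), and uncountably many algebraic fibres force
every fibre over a curve (`mem_algebraicClasses_of_not_countable_of_curveBase`).
[cite: CharlesSchnell2014Notes, Prop. 11.3.11 (proof) and Lemma 11.3.14]
[cite: Voisin2007HodgeLoci, §0 (Introduction), first paragraph] -/
theorem genericPropagation_isQuasiProjective_of_uncountablePropagation
    (hU : ∀ (k : Type) [Field k] [Countable k] (σ : k →+* ℂ) ⦃n : ℕ⦄ ⦃𝒳₀ S₀ : SchemeOver k⦄
      (f₀ : 𝒳₀ ⟶ S₀),
      IsSmoothProjectiveFamily ((baseChangeHom σ).map f₀) n →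
      IrreducibleSpace ((baseChangeHom σ).obj S₀).left → IsAffine ((baseChangeHom σ).obj S₀).left →
      AlgebraicGeometry.Smooth ((baseChangeHom σ).obj S₀).hom →
      topologicalKrullDim ((baseChangeHom σ).obj S₀).left = 1 →
      IsQuasiProjectiveOver ((baseChangeHom σ).obj 𝒳₀) →
      ∀ (p : ℕ) (A : complexBetti ((baseChangeHom σ).obj 𝒳₀) (2 * p))
        (s : ComplexPoints ((baseChangeHom σ).obj S₀)),
        closure {(baseChangeHomFst σ S₀).base s.pt} = (Set.univ : Set S₀.left) →
        complexBetti.map (fiberι ((baseChangeHom σ).map f₀) s) (2 * p) A ∈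
          algebraicClasses (fiberOver ((baseChangeHom σ).map f₀) s) p →
        ¬ {t : ComplexPoints ((baseChangeHom σ).obj S₀) |
            complexBetti.map (fiberι ((baseChangeHom σ).map f₀) t) (2 * p) A ∈
              algebraicClasses (fiberOver ((baseChangeHom σ).map f₀) t) p}.Countable) :
    ∀ (k : Type) [Field k] [Countable k] (σ : k →+* ℂ) ⦃n : ℕ⦄ ⦃𝒳₀ S₀ : SchemeOver k⦄
      (f₀ : 𝒳₀ ⟶ S₀),
      IsSmoothProjectiveFamily ((baseChangeHom σ).map f₀) n →
      IrreducibleSpace ((baseChangeHom σ).obj S₀).left → IsAffine ((baseChangeHom σ).obj S₀).left →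
      AlgebraicGeometry.Smooth ((baseChangeHom σ).obj S₀).hom →
      topologicalKrullDim ((baseChangeHom σ).obj S₀).left = 1 →
      IsQuasiProjectiveOver ((baseChangeHom σ).obj 𝒳₀) →
      ∀ (p : ℕ) (A : complexBetti ((baseChangeHom σ).obj 𝒳₀) (2 * p))
        (s : ComplexPoints ((baseChangeHom σ).obj S₀)),
        (∀ Z : Set (ComplexPoints ((baseChangeHom σ).obj S₀)),
          IsDefinedOver σ S₀ σ.fieldRange Z → s ∈ Z → Z = Set.univ) →
        complexBetti.map (fiberι ((baseChangeHom σ).map f₀) s) (2 * p) A ∈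
          algebraicClasses (fiberOver ((baseChangeHom σ).map f₀) s) p →
        ∀ t : ComplexPoints ((baseChangeHom σ).obj S₀),
          complexBetti.map (fiberι ((baseChangeHom σ).map f₀) t) (2 * p) A ∈
            algebraicClasses (fiberOver ((baseChangeHom σ).map f₀) t) p := by
  intro k _ _ σ n 𝒳₀ S₀ f₀ hf hirr haff hsm hdim h𝒳 p A s hs hA t
  haveI := hsm
  haveI := hirr
  haveI := irreducibleSpace_of_baseChangeHom σ S₀
  have hgen : (baseChangeHomFst σ S₀).base s.pt = genericPoint S₀.left :=
    base_pt_eq_genericPoint_of_isGenericPoint σ S₀ hs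
  have hdense : closure {(baseChangeHomFst σ S₀).base s.pt} = (Set.univ : Set S₀.left) := by
    rw [hgen]; exact genericPoint_closure _
  exact mem_algebraicClasses_of_not_countable_of_curveBase ((baseChangeHom σ).map f₀) hf hirr haff
    hsm hdim h𝒳 p A (hU k σ f₀ hf hirr haff hsm hdim h𝒳 p A s hdense hA) (fun t ht => ht) t

/-- The same reduction with the quasi-projectivity hypothesis on the `k`-form `𝒳₀` (it passes to
the complexification, `IsQuasiProjectiveOver.baseChangeHom`) — e.g. `f₀` a projective morphism to the
affine curve `S₀`, the printed setting of Voisin 2007 §3 / Charles–Schnell §11.3.3.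
[cite: CharlesSchnell2014Notes, §11.3.3 (standing hypotheses) and Prop. 11.3.11] -/
theorem isQuasiProjectiveOver_baseChangeHom_of_isQuasiProjectiveOver {k : Type} [Field k]
    (σ : k →+* ℂ) {𝒳₀ : SchemeOver k} (h : IsQuasiProjectiveOver 𝒳₀) :
    IsQuasiProjectiveOver ((baseChangeHom σ).obj 𝒳₀) :=
  IsQuasiProjectiveOver.baseChangeHom σ h

end Reduction

/-! ### The trivial degree ranges of STUB G, unconditionally -/

section Trivial

/-- **STUB G in the degree ranges `p = 0` and `p > n`, for ALL data, unconditionally** (binder for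
binder the stub with the extra hypothesis `p = 0 ∨ n < p`): `N⁰ H⁰ = H⁰`, and `H²ᵖ(𝒳_t(ℂ); ℂ) = 0`
for `p > n = dim 𝒳_t` (`HodgeLocusPropagation_zero`, `HodgeLocusPropagation_of_lt`). [folklore] -/
theorem genericPropagation_of_eq_zero_or_lt
    (k : Type) [Field k] [Countable k] (σ : k →+* ℂ) ⦃n : ℕ⦄ ⦃𝒳₀ S₀ : SchemeOver k⦄
    (f₀ : 𝒳₀ ⟶ S₀) (hf : IsSmoothProjectiveFamily ((baseChangeHom σ).map f₀) n)
    (_hirr : IrreducibleSpace ((baseChangeHom σ).obj S₀).left)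
    (_haff : IsAffine ((baseChangeHom σ).obj S₀).left)
    (_hsm : AlgebraicGeometry.Smooth ((baseChangeHom σ).obj S₀).hom)
    (_hdim : topologicalKrullDim ((baseChangeHom σ).obj S₀).left = 1)
    (p : ℕ) (hp : p = 0 ∨ n < p) (A : complexBetti ((baseChangeHom σ).obj 𝒳₀) (2 * p))
    (s : ComplexPoints ((baseChangeHom σ).obj S₀))
    (_hs : ∀ Z : Set (ComplexPoints ((baseChangeHom σ).obj S₀)),
      IsDefinedOver σ S₀ σ.fieldRange Z → s ∈ Z → Z = Set.univ)
    (_hA : complexBetti.map (fiberι ((baseChangeHom σ).map f₀) s) (2 * p) A ∈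
      algebraicClasses (fiberOver ((baseChangeHom σ).map f₀) s) p)
    (t : ComplexPoints ((baseChangeHom σ).obj S₀)) :
    complexBetti.map (fiberι ((baseChangeHom σ).map f₀) t) (2 * p) A ∈
      algebraicClasses (fiberOver ((baseChangeHom σ).map f₀) t) p := by
  rcases hp with rfl | hlt
  · exact HodgeLocusPropagation_zero ((baseChangeHom σ).map f₀) A t
  · exact HodgeLocusPropagation_of_lt ((baseChangeHom σ).map f₀) hf hlt A t

end Trivial

end Summit.HodgeConjecture.HodgeConjecture.Theorems

end
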